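import Summits.BirchSwinnertonDyer.Rank1Residual.Additive.KatoDescentLocPKummerLogOfClass
import Literature.NumberTheory.EllipticCurves.IntegralH1LocalisationRankDictionary
import Literature.NumberTheory.EllipticCurves.PAdicLFunction
import Literature.NumberTheory.EllipticCurves.Kato2004.IwasawaH1ReductionPkSemilinear
import Mathlib.LinearAlgebra.Dimension.Finite
import Mathlib.LinearAlgebra.Dimension.Localization
import HarnessLib

set_option linter.dupNamespace false
set_option autoImplicit false

/-!
# Support P2 `StrictCapGivesSelmerCap` (stmt-BirchSwinnertonDyer-23031, route `DerivedKatoValuationDoor`) at odd good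
# primes REDUCED BY NAME to the printed rank dictionary: «strict rank ≤ 1 ⇒ s_p ≤ 2» ⟸
# `PerrinRiou1993.rank_kummerIntegralH1_eq_selmerCorank` ∧ `KuriharaPollack2007.lemma14_locP_image_rankOne` (rank-`≤ 1` half)
# (INPUTS desk, τ7 follow-up; seat `bsd-inputs-honda-p1` g14; helper `--supports 23031`, closes nothing)

The support P2 of route `DerivedKatoValuationDoor` (a binder of `closes`; kept by the tenure's (β) re-split as the
step `hstr → s_p ≤ 2`) reads: for `W/ℚ` globally minimal and a prime `p`, if any two STRICT integral classes of
`H¹(ℤ[1/p], T_pW)` (`integralH1 (tateRep W p) p ⊤`, `∀ k, locModPk W p k · = 0`) are `ℤ_p`-dependent, then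
`W.selmerCorank p ≤ 2`.  Its docstring: «the compact Selmer group maps to `E(ℚ_p) ⊗ ℤ_p` of `ℤ_p`-rank `1` with
kernel the strict part» (Kummer bookkeeping, print, M).  With the INPUTS desk's typed dictionary
(`Literature/NumberTheory/EllipticCurves/IntegralH1LocalisationRankDictionary.lean`) this is linear algebra:

  `s_p = rank_{ℤ_p} H¹_f(ℤ[1/p], T_pW)`                         (`PerrinRiou1993.rank_kummerIntegralH1_eq_selmerCorank`)
      `≤ rank_{ℤ_p} H¹(ℤ[1/p], T_pW)`                            (`kummerIntegralH1 ≤ integralH1`, `Submodule.rank_mono`)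
      `= rank (A ⧸ S) + rank S`                                   (rank–nullity over the domain `ℤ_p`, `S` = strict part)
      `≤ 1 + 1`                                                   ([KP07, Lemma 1.4] rank-`≤ 1` half: pair dependence modulo `S`;
                                                                   hypothesis: pair dependence inside `S`).

* §1 `rank_integralH1_le_two_of_locPairDependent_of_strictPairDependent` — UNCONDITIONAL linear algebra at `(W, p)`:
  pair dependence modulo the strict part (the rank-`≤ 1` half of [KP07, L.1.4] as a hypothesis) and pair dependence
  inside the strict part give `rank_{ℤ_p} H¹(ℤ[1/p], T_pW) ≤ 2`; the strict part is built inline as a submodule of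
  `↥(integralH1 …)` (semilinearity `ContraCount.locModPk_smul_eq_locModPk_appr_smul`; this file is route-independent: it imports no `Theses` file).
* §2 `selmerCorank_le_two_of_strictPairDependent_of_rankDict_of_lemma14` (per `(W, p)`, `p` odd good) and
  `strictCapGivesSelmerCap_oddGood_of_rankDict_of_lemma14`: P2's implication at every odd prime of good reduction
  (in particular at every door prime, where `closes` uses it) from the two named facts BY NAME.  The item's own
  signature quantifies over ALL primes; the facts carry the papers' standing hypotheses `p ≠ 2`, good reduction, so
  this helper serves the item at odd good `p` only (enough for `closes`, which applies P2 at a door prime).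
* §3 `lemme239_of_rankDict`: the ε-version `PerrinRiou1993.lemme239_rank_integralH1_eq_selmerCorank` FOLLOWS from
  the ε-free dictionary and the tree's Kurihara–Pollack line (`LocPKummer.hasLocPKummerLog_of_exists_log_ne_zero_of_mem_integralH1`):
  under `ε_p = 1` every integral class is Kummer at `p`, so `kummerIntegralH1 = integralH1` as far as rank goes.

HONEST FRAMING: §1 unconditional; §2–§3 CONDITIONAL reductions on named facts (D-0014); no item is closed; BSD is NOT
proved by any of this.  References: [KP07] = [cite: KuriharaPollack2007, §1.4 Lemma 1.4]; [PR93] = [cite: PerrinRiou1993AIF,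
§1.1–1.2, Lemme 2.3.9]; [Kato04] = [cite: Kato2004Asterisque, §14.1 (pp. 234–235)]; [Gr99] = [cite: Greenberg1999LNM, §1].
-/

noncomputable section

open scoped Classical

namespace Summit.BirchSwinnertonDyer.BirchSwinnertonDyer.Theorems.DerivedKatoValuationDoor

open Field
open Literature Literature.NumberTheory.GaloisRepresentations
open Literature.NumberTheory.EllipticCurves Literature.NumberTheory.EllipticCurves.Kato2004
open Literature.NumberTheory.EllipticCurves.Kato2004.EulerSystemValues

/-! ## §1 Linear algebra: pair dependence modulo the strict part + inside it ⟹ rank ≤ 2 -/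

section LinearAlgebra

variable (W : WeierstrassCurve ℚ) [W.IsElliptic] (p : ℕ) [Fact p.Prime] [ContinuousSMul ℤ_[p] (W.tateModule p)]


/-- **`rank_{ℤ_p} H¹(ℤ[1/p], T_pW) ≤ 2` from two pair-dependence hypotheses** (unconditional linear algebra over
the domain `ℤ_p`): (i) any two integral classes have a non-trivial `ℤ_p`-combination that is STRICT (`loc_p ≡ 0` at
every level — the rank-`≤ 1` half of [KP07, Lemma 1.4], here a hypothesis), and (ii) any two strict integral classes
are `ℤ_p`-dependent («strict rank `≤ 1`», the hypothesis of P2 `StrictCapGivesSelmerCap`).  Proof: with `S` the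
strict part of `A = H¹(ℤ[1/p], T_pW)` (a submodule by the semilinearity of `loc_p mod p^k`), (ii) gives `rank S ≤ 1`, (i) gives
`rank (A ⧸ S) ≤ 1`, and rank–nullity `rank (A ⧸ S) + rank S = rank A`.
[cite: KuriharaPollack2007, §1.4 Lemma 1.4] [cite: BurnsKuriharaSano2019, Prop. 4.5 (proof)] -/
theorem rank_integralH1_le_two_of_locPairDependent_of_strictPairDependent
    (hKPa : ∀ x y : H1 (tateRep W p) ⊤,
      x ∈ integralH1 (tateRep W p) p ⊤ → y ∈ integralH1 (tateRep W p) p ⊤ →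
        ∃ a b : ℤ_[p], (a ≠ 0 ∨ b ≠ 0) ∧ ∀ k : ℕ, locModPk W p k (a • x + b • y) = 0)
    (hstr : ∀ x y : H1 (tateRep W p) ⊤,
      x ∈ integralH1 (tateRep W p) p ⊤ → y ∈ integralH1 (tateRep W p) p ⊤ →
        (∀ k : ℕ, locModPk W p k x = 0) → (∀ k : ℕ, locModPk W p k y = 0) →
          ∃ a b : ℤ_[p], (a ≠ 0 ∨ b ≠ 0) ∧ a • x + b • y = 0) :
    Module.rank ℤ_[p] ↥(integralH1 (tateRep W p) p ⊤) ≤ 2 := by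
  classical
  set A := integralH1 (tateRep W p) p ⊤ with hA
  -- the strict part of `A`, as a submodule of `↥A`
  let S : Submodule ℤ_[p] ↥A :=
    { carrier := {z | ∀ k : ℕ, locModPk W p k (z : H1 (tateRep W p) ⊤) = 0}
      zero_mem' := fun k ↦ by rw [Submodule.coe_zero, map_zero]
      add_mem' := fun {z z'} hz hz' k ↦ by rw [Submodule.coe_add, map_add, hz k, hz' k, add_zero]
      smul_mem' := fun c z hz k ↦ by
        -- `loc_p mod p^k` only sees `c` through `c mod p^k` (`ContraCount.locModPk_smul_eq_locModPk_appr_smul`)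
        rw [Submodule.coe_smul,
          Summit.BirchSwinnertonDyer.Rank1Residual.Additive.ContraCount.locModPk_smul_eq_locModPk_appr_smul,
          map_nsmul, hz k, smul_zero] }
  have hS_mem : ∀ z : ↥A, z ∈ S ↔ ∀ k : ℕ, locModPk W p k (z : H1 (tateRep W p) ⊤) = 0 := fun z ↦ Iff.rfl
  -- (ii) ⟹ `rank S ≤ 1`
  have hS : Module.rank ℤ_[p] ↥S ≤ 1 := by
    refine rank_le fun s hs => ?_
    by_contra hlt
    push Not at hlt
    obtain ⟨x, hx, y, hy, hxy⟩ := Finset.one_lt_card.mp hlt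
    obtain ⟨a, b, hab, hrel⟩ := hstr ((x : ↥A) : H1 (tateRep W p) ⊤) ((y : ↥A) : H1 (tateRep W p) ⊤)
      (x : ↥A).2 (y : ↥A).2 ((hS_mem _).1 x.2) ((hS_mem _).1 y.2)
    let f : Fin 2 → ↥s := ![⟨x, hx⟩, ⟨y, hy⟩]
    have hf : Function.Injective f := by
      intro i j hij
      fin_cases i <;> fin_cases j
      · rfl
      · exact absurd (congrArg (fun z : ↥s => (z : ↥S)) hij) hxy
      · exact absurd (congrArg (fun z : ↥s => (z : ↥S)) hij).symm hxy
      · rfl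
    have hli := hs.comp f hf
    have hsum : ∑ i : Fin 2, (![a, b] i) • ((fun i : ↥s => (i : ↥S)) ∘ f) i = 0 := by
      rw [Fin.sum_univ_two]
      apply Subtype.ext
      apply Subtype.ext
      change (((a • x + b • y : ↥S) : ↥A) : H1 (tateRep W p) ⊤) = 0
      push_cast
      exact hrel
    have h0 := Fintype.linearIndependent_iff.mp hli ![a, b] hsum
    rcases hab with ha | hb
    · exact ha (by simpa using h0 0)
    · exact hb (by simpa using h0 1)
  -- (i) ⟹ `rank (A ⧸ S) ≤ 1`
  have hQ : Module.rank ℤ_[p] (↥A ⧸ S) ≤ 1 := by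
    refine rank_le fun s hs => ?_
    by_contra hlt
    push Not at hlt
    obtain ⟨xq, hxq, yq, hyq, hxy⟩ := Finset.one_lt_card.mp hlt
    obtain ⟨x, rfl⟩ := Submodule.mkQ_surjective S xq
    obtain ⟨y, rfl⟩ := Submodule.mkQ_surjective S yq
    obtain ⟨a, b, hab, hrel⟩ := hKPa (x : H1 (tateRep W p) ⊤) (y : H1 (tateRep W p) ⊤) x.2 y.2
    have hmem : a • x + b • y ∈ S := by
      rw [hS_mem]
      intro k
      have : ((a • x + b • y : ↥A) : H1 (tateRep W p) ⊤) = a • (x : H1 (tateRep W p) ⊤) + b • (y : _) := by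
        push_cast; rfl
      rw [this]
      exact hrel k
    let f : Fin 2 → ↥s := ![⟨S.mkQ x, hxq⟩, ⟨S.mkQ y, hyq⟩]
    have hf : Function.Injective f := by
      intro i j hij
      fin_cases i <;> fin_cases j
      · rfl
      · exact absurd (congrArg (fun z : ↥s => (z : ↥A ⧸ S)) hij) hxy
      · exact absurd (congrArg (fun z : ↥s => (z : ↥A ⧸ S)) hij).symm hxy
      · rfl
    have hli := hs.comp f hf
    have hsum : ∑ i : Fin 2, (![a, b] i) • ((fun i : ↥s => (i : ↥A ⧸ S)) ∘ f) i = 0 := by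
      rw [Fin.sum_univ_two]
      change a • S.mkQ x + b • S.mkQ y = 0
      rw [← map_smul, ← map_smul, ← map_add, Submodule.mkQ_apply, Submodule.Quotient.mk_eq_zero]
      exact hmem
    have h0 := Fintype.linearIndependent_iff.mp hli ![a, b] hsum
    rcases hab with ha | hb
    · exact ha (by simpa using h0 0)
    · exact hb (by simpa using h0 1)
  -- rank–nullity over the domain `ℤ_p`
  have hsum := Submodule.rank_quotient_add_rank S
  calc Module.rank ℤ_[p] ↥A = Module.rank ℤ_[p] (↥A ⧸ S) + Module.rank ℤ_[p] ↥S := hsum.symm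
    _ ≤ 1 + 1 := add_le_add hQ hS
    _ = 2 := by norm_num

end LinearAlgebra

/-! ## §2 P2 at odd good primes from the dictionary and [KP07, Lemma 1.4] -/

section SelmerCap

variable (W : WeierstrassCurve ℚ) [W.IsElliptic] [W.IsGloballyMinimal] (p : ℕ) [Fact p.Prime]
  [ContinuousSMul ℤ_[p] (W.tateModule p)]

/-- **P2 at `(W, p)`, `p` odd of good reduction, BY NAME**: if `rank_{ℤ_p} H¹_f(ℤ[1/p], T_pW) = s_p`
(`PerrinRiou1993.rank_kummerIntegralH1_eq_selmerCorank`) and the localisation image has rank exactly one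
(`KuriharaPollack2007.lemma14_locP_image_rankOne`; only its rank-`≤ 1` half is used), then strict pair dependence
forces `W.selmerCorank p ≤ 2`: `s_p = rank (kummerIntegralH1) ≤ rank (integralH1) ≤ 2` (§1, `Submodule.rank_mono`).
CONDITIONAL on the two named facts.  [cite: PerrinRiou1993AIF, §1.1–1.2 and Lemme 2.3.9]
[cite: KuriharaPollack2007, §1.4 Lemma 1.4] [cite: Kato2004Asterisque, §14.1 (pp. 234–235)] -/
theorem selmerCorank_le_two_of_strictPairDependent_of_rankDict_of_lemma14
    (hSel : PerrinRiou1993.rank_kummerIntegralH1_eq_selmerCorank)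
    (hKP : KuriharaPollack2007.lemma14_locP_image_rankOne)
    (hp2 : p ≠ 2) (hgood : W.HasGoodReductionAtPrime p)
    (hstr : ∀ x y : H1 (tateRep W p) ⊤,
      x ∈ integralH1 (tateRep W p) p ⊤ → y ∈ integralH1 (tateRep W p) p ⊤ →
        (∀ k : ℕ, locModPk W p k x = 0) → (∀ k : ℕ, locModPk W p k y = 0) →
          ∃ a b : ℤ_[p], (a ≠ 0 ∨ b ≠ 0) ∧ a • x + b • y = 0) :
    W.selmerCorank p ≤ 2 := by
  have hA : Module.rank ℤ_[p] ↥(integralH1 (tateRep W p) p ⊤) ≤ 2 :=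
    rank_integralH1_le_two_of_locPairDependent_of_strictPairDependent W p (hKP W p hp2 hgood).1 hstr
  have hK : Module.rank ℤ_[p] ↥(kummerIntegralH1 W p) ≤ Module.rank ℤ_[p] ↥(integralH1 (tateRep W p) p ⊤) :=
    Submodule.rank_mono (kummerIntegralH1_le_integralH1 W p)
  have h : (W.selmerCorank p : Cardinal) ≤ 2 := by
    rw [← hSel W p hp2 hgood]
    exact hK.trans hA
  exact_mod_cast h

end SelmerCap

/-- **P2 `StrictCapGivesSelmerCap` at odd primes of good reduction, from the two named facts BY NAME** (route shape:
the item's hypothesis verbatim, conclusion `W.selmerCorank p ≤ 2`, for every globally minimal `W/ℚ` and every ODD prime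
`p` of GOOD reduction — the standing hypotheses of the typed facts; the item itself quantifies over all primes, and
`closes` applies it at a door prime, `5 ≤ p` good ordinary).  CONDITIONAL on the two named facts; helper for
stmt-BirchSwinnertonDyer-23031, which it does not close.  BSD is not proved by any of this.
[cite: PerrinRiou1993AIF, §1.1–1.2 and Lemme 2.3.9] [cite: KuriharaPollack2007, §1.4 Lemma 1.4] -/
theorem strictCapGivesSelmerCap_oddGood_of_rankDict_of_lemma14
    (hSel : PerrinRiou1993.rank_kummerIntegralH1_eq_selmerCorank)
    (hKP : KuriharaPollack2007.lemma14_locP_image_rankOne) :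
    ∀ (W : WeierstrassCurve ℚ) [W.IsElliptic] [W.IsGloballyMinimal] (p : ℕ) [Fact p.Prime]
      [ContinuousSMul ℤ_[p] (W.tateModule p)], p ≠ 2 → W.HasGoodReductionAtPrime p →
      (∀ x y : H1 (tateRep W p) ⊤,
        x ∈ integralH1 (tateRep W p) p ⊤ → y ∈ integralH1 (tateRep W p) p ⊤ →
          (∀ k : ℕ, locModPk W p k x = 0) → (∀ k : ℕ, locModPk W p k y = 0) →
            ∃ a b : ℤ_[p], (a ≠ 0 ∨ b ≠ 0) ∧ a • x + b • y = 0) →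
      W.selmerCorank p ≤ 2 := by
  intro W _ _ p _ _ hp2 hgood hstr
  exact selmerCorank_le_two_of_strictPairDependent_of_rankDict_of_lemma14 W p hSel hKP hp2 hgood hstr

/-- **P2 at DOOR primes** (the shape `closes` consumes: `5 ≤ p`, good ordinary, `ρ̄` onto): from the two named facts
BY NAME, since a door prime is odd and of good reduction (`isOrdinaryAt_iff`).  CONDITIONAL on the named facts.
[cite: PerrinRiou1993AIF, §1.1–1.2 and Lemme 2.3.9] [cite: KuriharaPollack2007, §1.4 Lemma 1.4] -/
theorem strictCapGivesSelmerCap_door_of_rankDict_of_lemma14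
    (hSel : PerrinRiou1993.rank_kummerIntegralH1_eq_selmerCorank)
    (hKP : KuriharaPollack2007.lemma14_locP_image_rankOne) :
    ∀ (W : WeierstrassCurve ℚ) [W.IsElliptic] [W.IsGloballyMinimal] (p : ℕ) [Fact p.Prime]
      [ContinuousSMul ℤ_[p] (W.tateModule p)],
      (5 ≤ p ∧ Literature.NumberTheory.EllipticCurves.IsOrdinaryAt W p ∧ W.HasSurjectiveModNGaloisRep p) →
      (∀ x y : H1 (tateRep W p) ⊤,
        x ∈ integralH1 (tateRep W p) p ⊤ → y ∈ integralH1 (tateRep W p) p ⊤ →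
          (∀ k : ℕ, locModPk W p k x = 0) → (∀ k : ℕ, locModPk W p k y = 0) →
            ∃ a b : ℤ_[p], (a ≠ 0 ∨ b ≠ 0) ∧ a • x + b • y = 0) →
      W.selmerCorank p ≤ 2 := by
  intro W _ _ p _ _ hdoor hstr
  have hp2 : p ≠ 2 := by
    have h5 := hdoor.1
    omega
  have hgood : W.HasGoodReductionAtPrime p := ((isOrdinaryAt_iff W p).1 hdoor.2.1).1
  exact selmerCorank_le_two_of_strictPairDependent_of_rankDict_of_lemma14 W p hSel hKP hp2 hgood hstr

/-! ## §3 The ε-version follows from the ε-free dictionary (and the tree's Kurihara–Pollack line) -/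

/-- **`PerrinRiou1993.lemme239_rank_integralH1_eq_selmerCorank` ⟸ `PerrinRiou1993.rank_kummerIntegralH1_eq_selmerCorank`**:
under `ε_p = 1` (one integral class with a Kummer localisation of non-zero logarithm) EVERY integral class is Kummer at
`p` (tree theorem `LocPKummer.hasLocPKummerLog_of_exists_log_ne_zero_of_mem_integralH1`), so `integralH1 ≤ kummerIntegralH1`
and the two submodules have the same rank; the ε-free dictionary then reads `rank_{ℤ_p} H¹(ℤ[1/p], T_pW) = s_p`.  Hence the
ε-version adds no trust beyond the ε-free fact.  CONDITIONAL on the ε-free named fact.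
[cite: PerrinRiou1993AIF, Lemme 2.3.9 (p. 967)] [cite: KuriharaPollack2007, §1.4 Lemma 1.4] -/
theorem lemme239_of_rankDict (hSel : PerrinRiou1993.rank_kummerIntegralH1_eq_selmerCorank) :
    PerrinRiou1993.lemme239_rank_integralH1_eq_selmerCorank := by
  intro W _ _ p _ _ hp2 hgood hx
  have hle : integralH1 (tateRep W p) p ⊤ ≤ kummerIntegralH1 W p := by
    intro y hy
    obtain ⟨t', ht'⟩ :=
      Summit.BirchSwinnertonDyer.Rank1Residual.Additive.LocPKummer.hasLocPKummerLog_of_exists_log_ne_zero_of_mem_integralH1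
        W p hx hy
    exact mem_kummerIntegralH1_of_hasLocPKummerLog W p hy ht'
  have hge : kummerIntegralH1 W p ≤ integralH1 (tateRep W p) p ⊤ := kummerIntegralH1_le_integralH1 W p
  have heq : kummerIntegralH1 W p = integralH1 (tateRep W p) p ⊤ := le_antisymm hge hle
  rw [← heq]
  exact hSel W p hp2 hgood

/-! ## §4 Brick X≤2 of the dictionary's discharge road: ONE Selmer multiplier for ALL of `H¹(ℤ[1/p], T_pW)`

Appended (same seat, same session).  The NEEDS-X road for the `≤` half of
`PerrinRiou1993.rank_kummerIntegralH1_eq_selmerCorank` / `…lemme239_…` (HOME/NEEDS-X-tau7-rank-dictionary.md, evidence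
#9 on stmt-BirchSwinnertonDyer-23259) lists X≤2 = «a UNIFORM `M ≠ 0` with `M • red_{p^{k+1}} y ∈ Sel^{(p^{k+1})}(W/ℚ)` for
every integral `y` and every `k`»; the tree has it PER CLASS (`LocPKummer.exists_uniform_nsmul_mem_selmerGroup_of_class`,
its `M` depending on `y`).  Finite generation of `H¹(ℤ[1/p], T_pW)` over `ℤ_p` (`Kato2004.module_finite_integralH1_top`)
and the `ℤ_p`-semilinearity of the reduction (`reduceH1Pk_smul_nat`) make it uniform: take the product of the
multipliers of a finite generating set.  Unconditional given ONE integral class with a Kummer localisation of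
non-zero logarithm (`ε_p = 1`; at door primes: the rider `CrisAtDoorPrimes`). -/

section UniformMultiplier

variable (W : WeierstrassCurve ℚ) [W.IsElliptic] [W.IsGloballyMinimal] (p : ℕ) [Fact p.Prime]
  [ContinuousSMul ℤ_[p] (W.tateModule p)]

/-- **Uniform Selmer multiplier (X≤2).**  If some integral class has a Kummer localisation of non-zero logarithm,
there is ONE `M ≠ 0` such that for EVERY `y ∈ H¹(ℤ[1/p], T_pW)` and every `k`, `M • red_{p^{k+1}}(y)` (read in
`H¹(Γ_ℚ, W[p^{k+1}])`) lies in the `p^{k+1}`-Selmer group `Sel^{(p^{k+1})}(W/ℚ)`.  Proof: per-class multipliers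
(`LocPKummer.exists_uniform_nsmul_mem_selmerGroup_of_class`, fed by `exists_point_kummerOutside_of_hasLocPKummerLog`)
for a finite `ℤ_p`-generating set of the finitely generated `integralH1` (`Kato2004.module_finite_integralH1_top`),
multiplied together; a general `y = ∑ c_g • g` reduces to `∑ (c_g mod p^{k+1}) • red g` (`reduceH1Pk_smul_nat`), and the
Selmer group is a subgroup.  [cite: KuriharaPollack2007, §1.4 Lemma 1.4 and proof of Prop. 3.4 (2)]
[cite: Kato2004Asterisque, §14.9 (14.9.3) (p. 240) and §8.2 Lemma 8.5] -/
theorem exists_uniform_nsmul_reduceH1Pk_mem_selmerGroup_of_exists_log_ne_zero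
    (hx : ∃ (x : H1 (tateRep W p) ⊤) (t : ℚ_[p]),
      x ∈ integralH1 (tateRep W p) p ⊤ ∧ t ≠ 0 ∧ HasLocPKummerLog W p x t) :
    ∃ M : ℕ, M ≠ 0 ∧ ∀ y : H1 (tateRep W p) ⊤, y ∈ integralH1 (tateRep W p) p ⊤ → ∀ k : ℕ,
      M • (ofTopSubgroup (W.torsionGaloisModule ((p : ℤ) ^ (k + 1))).toTopRep 1).hom
          (reduceH1Pk W p (k + 1) ⊤ y) ∈ WeierstrassCurve.selmerGroup W ((p : ℤ) ^ (k + 1)) := by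
  classical
  obtain ⟨x, t, hxA, ht, hxt⟩ := hx
  obtain ⟨P₀, hP₀, hξ⟩ :=
    Summit.BirchSwinnertonDyer.Rank1Residual.Additive.LocPKummer.exists_point_kummerOutside_of_hasLocPKummerLog
      W p hxA ht hxt
  set A := integralH1 (tateRep W p) p ⊤ with hA
  -- per-class multipliers
  have hcls : ∀ g : ↥A, ∃ M : ℕ, M ≠ 0 ∧ ∀ k : ℕ,
      M • (ofTopSubgroup (W.torsionGaloisModule ((p : ℤ) ^ (k + 1))).toTopRep 1).hom
          (reduceH1Pk W p (k + 1) ⊤ (g : H1 (tateRep W p) ⊤)) ∈ WeierstrassCurve.selmerGroup W ((p : ℤ) ^ (k + 1)) :=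
    fun g ↦
      Summit.BirchSwinnertonDyer.Rank1Residual.Additive.LocPKummer.exists_uniform_nsmul_mem_selmerGroup_of_class
        W p g.2 hP₀ hξ
  choose M hM0 hM using hcls
  -- a finite generating set of `A` over `ℤ_p`
  haveI : Module.Finite ℤ_[p] ↥A := module_finite_integralH1_top W p
  obtain ⟨s, hs⟩ := Module.Finite.fg_top (R := ℤ_[p]) (M := ↥A)
  refine ⟨∏ g ∈ s, M g, Finset.prod_ne_zero_iff.mpr fun g _ ↦ hM0 g, fun y hy k ↦ ?_⟩
  -- write `y` on the generators
  have hmem : (⟨y, hy⟩ : ↥A) ∈ Submodule.span ℤ_[p] (s : Set ↥A) := by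
    rw [hs]; exact Submodule.mem_top
  obtain ⟨f, -, hf⟩ := Submodule.mem_span_finset.mp hmem
  have hy' : y = ∑ a ∈ s, f a • (a : H1 (tateRep W p) ⊤) := by
    have h := congrArg (fun z : ↥A ↦ (z : H1 (tateRep W p) ⊤)) hf
    simp only [Submodule.coe_sum, Submodule.coe_smul] at h
    exact h.symm
  rw [hy', map_sum, map_sum, Finset.smul_sum]
  refine AddSubgroup.sum_mem _ fun a ha ↦ ?_
  rw [reduceH1Pk_smul_nat, map_nsmul, smul_comm, ← Finset.prod_erase_mul s M ha, mul_smul]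
  exact AddSubgroup.nsmul_mem _ (AddSubgroup.nsmul_mem _ (hM a k) _) _

end UniformMultiplier

end Summit.BirchSwinnertonDyer.BirchSwinnertonDyer.Theorems.DerivedKatoValuationDoor

end
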